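import Summits.AnomalousDissipation.AnomalousDissipation.Theorems.SawtoothPulseCascadeApproxDuhamel
import Summits.AnomalousDissipation.AnomalousDissipation.Theorems.SawtoothPulseCascadeApproxProfileDeriv
import Summits.AnomalousDissipation.AnomalousDissipation.Theorems.SawtoothPulseCascadeApproxLipTools

/-!
# Slot-wise Lipschitz bound of the forced linearised response
(route `AnomalousDissipation/SawtoothPulseCascade`; helper for the crux ApproxSol58 =
stmt-AnomalousDissipation-19688, S2 `stub_responseLipEnvelope` of the lead's reshaped line `linear-response-lip`:
the realignment pipeline, global level, LIPSCHITZ norm)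

The Lipschitz twin of `…ApproxDuhamel.response_slot_bound`.  With the slot clock `σ k = tInject (k/2) (k even)`,
the forced response `(L, q)` on `[0, T']` from zero, the realigned comb profiles `g k` and the homogeneous pieces `W k`
(classical solutions on `[σ k, T']` from `g k` laid parallel to the pulse of slot `k`), the landed identities
`L(σ k) = Σ_{i<k} W i (σ k)` (`response_at_slotStart`) and `L = Σ_{i<k} W i + F_k(·, x_⊥) e_∥` on slot `k`
(`slot_split_H/V`, uniqueness) give, for every slot `k < K`, every `t` in it, every point `x` and direction `i`:

`‖∂ᵢ L(t)(x)‖ ≤ Σ_{l<k} ‖D(W l (t))(x)‖ + 24π√(2π) ν N_{k/2}² γ / δ_{k/2}²`,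

the last term being the Lipschitz size of the running slot's own parallel profile
(`…ApproxProfileDeriv.abs_deriv_forcedProfile_le`, `∫|rate| ≤ γ`).  The per-phase Lipschitz cap bounds each
`‖D(W l (t))‖` (next file).
-/

set_option linter.dupNamespace false

noncomputable section

namespace Summit.AnomalousDissipation.AnomalousDissipation.Theorems.SawtoothPulseCascade.ApproxResponse

open Set MeasureTheory
open scoped ContDiff InnerProductSpace
open Literature.Analysis Literature.Analysis.FunctionSpaces Literature.Analysis.FluidPDE
open Literature.Analysis.FluidPDE.SawtoothCascade
open Literature.Analysis.FluidPDE.SawtoothCascade.CascadeParams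
open Summit.AnomalousDissipation.AnomalousDissipation.Theorems.SawtoothPulseCascade.K2Classical

/-! ## §1 The Lipschitz size of a slot's own parallel profile -/

/-- **Lipschitz size of the forced parallel profile of an H half-slot**: for the forced profile `F` from zero driven
by the heat lag `ν rateH_j U_j''` on `[tStart j, tStart j + tHalf j]`,
`|∂_y F(t, y)| ≤ 24π√(2π) ν N_j² γ / δ_j²` (`∫|rateH_j| ≤ γ`). -/
theorem abs_deriv_slotProfile_H_le (P : CascadeParams) (hδ₀ : 0 < P.δ₀) (hd : 0 < P.d) (hγ : 0 ≤ P.γ) {j : ℕ}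
    (hN : P.N j ≠ 0) {ν : ℝ} (hν : 0 < ν) {F : ℝ → ℝ → ℝ}
    (hF : ContDiffOn ℝ ∞ (Function.uncurry F) (Icc (tStart j) (tStart j + tHalf j) ×ˢ univ))
    (hFper : ∀ t ∈ Icc (tStart j) (tStart j + tHalf j), Function.Periodic (F t) 1)
    (hF0 : F (tStart j) = (fun _ => 0))
    (heatF : ∀ t ∈ Icc (tStart j) (tStart j + tHalf j), ∀ y,
      derivWithin (fun s => F s y) (Icc (tStart j) (tStart j + tHalf j)) t =
        ν * deriv (deriv (F t)) y + ν * (P.rateH j t * deriv (deriv (P.U j)) y))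
    {t : ℝ} (ht : t ∈ Icc (tStart j) (tStart j + tHalf j)) (y : ℝ) :
    |deriv (F t) y| ≤ 24 * Real.pi * Real.sqrt (2 * Real.pi) * ν * ((P.N j : ℕ) : ℝ) ^ 2 * P.γ / P.δ j ^ 2 := by
  have hlt : tStart j < tStart j + tHalf j := by linarith [tHalf_pos j]
  have hδ := P.δ_pos hδ₀ hd j
  have heat' : ∀ s ∈ Icc (tStart j) (tStart j + tHalf j), ∀ z,
      derivWithin (fun τ => F τ z) (Icc (tStart j) (tStart j + tHalf j)) s =
        ν * deriv (deriv (F s)) z + P.rateH j s * (ν * deriv (deriv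
          (fun y : ℝ => roundedSaw (P.δ j) (2 * Real.pi * (P.N j : ℕ) * y) / (2 * Real.pi * (P.N j : ℕ)))) z) := by
    intro s hs z
    rw [heatF s hs z, cascade_U_eq]
    ring
  have h := abs_deriv_forcedProfile_le hδ hN hlt hν.le hF hFper hF0 (P.contDiff_rateH j) heat' ht y
  rw [abs_of_pos hν] at h
  have hI : (∫ s in tStart j..t, |P.rateH j s|) ≤ P.γ := by
    rw [← integral_abs_rateH P hγ j]
    exact intervalIntegral.integral_mono_interval le_rfl ht.1 ht.2
      (ae_of_all _ fun s => abs_nonneg _) ((P.continuous_rateH j).abs.intervalIntegrable _ _)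
  have hK : 0 ≤ 24 * Real.pi * Real.sqrt (2 * Real.pi) * ν * ((P.N j : ℕ) : ℝ) ^ 2 := by positivity
  calc |deriv (F t) y|
      ≤ 24 * Real.pi * Real.sqrt (2 * Real.pi) * ν * ((P.N j : ℕ) : ℝ) ^ 2 * (∫ s in tStart j..t, |P.rateH j s|) /
          P.δ j ^ 2 := h
    _ ≤ 24 * Real.pi * Real.sqrt (2 * Real.pi) * ν * ((P.N j : ℕ) : ℝ) ^ 2 * P.γ / P.δ j ^ 2 := by
        gcongr

/-- **Lipschitz size of the forced parallel profile of a V half-slot** (twin of `abs_deriv_slotProfile_H_le` on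
`[tStart j + tHalf j, tStart (j+1)]` with the rate `rateV_j`). -/
theorem abs_deriv_slotProfile_V_le (P : CascadeParams) (hδ₀ : 0 < P.δ₀) (hd : 0 < P.d) (hγ : 0 ≤ P.γ) {j : ℕ}
    (hN : P.N j ≠ 0) {ν : ℝ} (hν : 0 < ν) {F : ℝ → ℝ → ℝ}
    (hF : ContDiffOn ℝ ∞ (Function.uncurry F) (Icc (tStart j + tHalf j) (tStart (j + 1)) ×ˢ univ))
    (hFper : ∀ t ∈ Icc (tStart j + tHalf j) (tStart (j + 1)), Function.Periodic (F t) 1)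
    (hF0 : F (tStart j + tHalf j) = (fun _ => 0))
    (heatF : ∀ t ∈ Icc (tStart j + tHalf j) (tStart (j + 1)), ∀ y,
      derivWithin (fun s => F s y) (Icc (tStart j + tHalf j) (tStart (j + 1))) t =
        ν * deriv (deriv (F t)) y + ν * (P.rateV j t * deriv (deriv (P.U j)) y))
    {t : ℝ} (ht : t ∈ Icc (tStart j + tHalf j) (tStart (j + 1))) (y : ℝ) :
    |deriv (F t) y| ≤ 24 * Real.pi * Real.sqrt (2 * Real.pi) * ν * ((P.N j : ℕ) : ℝ) ^ 2 * P.γ / P.δ j ^ 2 := by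
  have hlt : tStart j + tHalf j < tStart (j + 1) := by rw [tStart_succ]; linarith [tHalf_pos j]
  have hδ := P.δ_pos hδ₀ hd j
  have heat' : ∀ s ∈ Icc (tStart j + tHalf j) (tStart (j + 1)), ∀ z,
      derivWithin (fun τ => F τ z) (Icc (tStart j + tHalf j) (tStart (j + 1))) s =
        ν * deriv (deriv (F s)) z + P.rateV j s * (ν * deriv (deriv
          (fun y : ℝ => roundedSaw (P.δ j) (2 * Real.pi * (P.N j : ℕ) * y) / (2 * Real.pi * (P.N j : ℕ)))) z) := by
    intro s hs z
    rw [heatF s hs z, cascade_U_eq]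
    ring
  have h := abs_deriv_forcedProfile_le hδ hN hlt hν.le hF hFper hF0 (P.contDiff_rateV j) heat' ht y
  rw [abs_of_pos hν] at h
  have hI : (∫ s in (tStart j + tHalf j)..t, |P.rateV j s|) ≤ P.γ := by
    rw [← integral_abs_rateV P hγ j]
    have hend : tStart (j + 1) = tStart j + tHalf j + tHalf j := by rw [tStart_succ]; ring
    exact intervalIntegral.integral_mono_interval le_rfl ht.1 (ht.2.trans hend.le)
      (ae_of_all _ fun s => abs_nonneg _) ((P.continuous_rateV j).abs.intervalIntegrable _ _)
  have hK : 0 ≤ 24 * Real.pi * Real.sqrt (2 * Real.pi) * ν * ((P.N j : ℕ) : ℝ) ^ 2 := by positivity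
  calc |deriv (F t) y|
      ≤ 24 * Real.pi * Real.sqrt (2 * Real.pi) * ν * ((P.N j : ℕ) : ℝ) ^ 2 *
          (∫ s in (tStart j + tHalf j)..t, |P.rateV j s|) / P.δ j ^ 2 := h
    _ ≤ 24 * Real.pi * Real.sqrt (2 * Real.pi) * ν * ((P.N j : ℕ) : ℝ) ^ 2 * P.γ / P.δ j ^ 2 := by
        gcongr

/-- Pointwise Lipschitz reading of a split `v = Σ_{l ∈ s} w l + g(x_k) e_m`: for `C¹` summands and a smooth
`1`-periodic profile with `|g'| ≤ B`,  `‖∂ᵢ v(x)‖ ≤ Σ_{l ∈ s} ‖D(w l)(x)‖ + B`. -/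
theorem norm_partialDeriv_split_le {ι : Type*} (s : Finset ι)
    {w : ι → UnitAddTorus (Fin 2) → EuclideanSpace ℝ (Fin 2)} (hw : ∀ l ∈ s, Torus.IsContDiff 1 (w l))
    {g : ℝ → ℝ} (hg : Function.Periodic g 1) (hgs : ContDiff ℝ ∞ g) {B : ℝ} (hB : ∀ y, |deriv g y| ≤ B)
    (k m : Fin 2) (i : Fin 2) (x : UnitAddTorus (Fin 2)) :
    ‖Torus.partialDeriv i (fun y => (∑ l ∈ s, w l y) + g (Torus.repr y k) • EuclideanSpace.single m (1 : ℝ)) x‖ ≤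
      ∑ l ∈ s, ‖Torus.fderiv (w l) x‖ + B := by
  have hS : Torus.IsContDiff 1 (fun y => ∑ l ∈ s, w l y) := by
    have hl : Torus.lift (fun y => ∑ l ∈ s, w l y) = fun z => ∑ l ∈ s, Torus.lift (w l) z := rfl
    unfold Torus.IsContDiff
    rw [hl]
    exact ContDiff.sum fun l hl => hw l hl
  have hΦ : Torus.IsContDiff 1 (fun y : UnitAddTorus (Fin 2) => g (Torus.repr y k) • EuclideanSpace.single m (1 : ℝ)) :=
    (isSmooth_parallelShear (k := k) (m := m) hg hgs).isContDiff (by simp)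
  rw [partialDeriv_add_apply hS hΦ i x, Torus.partialDeriv_finset_sum s hw i x]
  refine (norm_add_le _ _).trans (add_le_add ?_ ?_)
  · exact (norm_sum_le _ _).trans (Finset.sum_le_sum fun l hl => norm_partialDeriv_le_norm_fderiv (hw l hl) i x)
  · exact norm_partialDeriv_parallel_le (k := k) (m := m) hg (hgs.differentiable (by simp)) hB i x

/-! ## §2 The slot-wise Lipschitz bound -/

section Duhamel

variable (P : CascadeParams) {ν T' : ℝ} {K : ℕ}
  {W : ℕ → ℝ → UnitAddTorus (Fin 2) → EuclideanSpace ℝ (Fin 2)} {R : ℕ → ℝ → UnitAddTorus (Fin 2) → ℝ}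

/-- **Slot-wise Lipschitz bound of the forced response.**  Under the hypotheses of `response_at_slotStart`, for
every slot `k < K`, every `t` in it, every point `x` and direction `i`:
`‖∂ᵢ L(t)(x)‖ ≤ Σ_{l<k} ‖D(W l (t))(x)‖ + 24π√(2π) ν N_{k/2}² γ / δ_{k/2}²`. -/
theorem response_slot_lip_bound (hδ₀ : 0 < P.δ₀) (hd : 0 < P.d) (hγ : 0 ≤ P.γ) (hN : ∀ j, P.N j ≠ 0)
    (hν : 0 < ν) (hK : CascadeParams.tInject (K / 2) (K % 2 == 0) ≤ T')
    {L : ℝ → UnitAddTorus (Fin 2) → EuclideanSpace ℝ (Fin 2)} {q : ℝ → UnitAddTorus (Fin 2) → ℝ}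
    (hL : Torus.IsSmoothSpaceTimeOn (Icc 0 T') L) (hq : Torus.IsSmoothSpaceTimeOn (Icc 0 T') q)
    (hLdiv : ∀ t ∈ Icc 0 T', Torus.IsDivFree (L t)) (hL0 : L 0 = fun _ => 0)
    (hlin : ∀ t ∈ Icc 0 T', ∀ x, Torus.timeDerivWithin (Icc 0 T') L t x + Torus.convect (P.field t) (L t) x +
      Torus.convect (L t) (P.field t) x =
        ν • Torus.laplacian (L t) x - Torus.gradient (q t) x + ν • Torus.laplacian (P.field t) x)
    {g : ℕ → ℝ → ℝ} (hg : ∀ k < K, ContDiff ℝ ∞ (g k) ∧ Function.Periodic (g k) 1)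
    (hrealH : ∀ j, 2 * j < K → ∀ c F : ℝ → ℝ → ℝ,
        ContDiffOn ℝ ∞ (Function.uncurry c) (Icc (tStart j) (tStart j + tHalf j) ×ˢ univ) →
        (∀ t ∈ Icc (tStart j) (tStart j + tHalf j), Function.Periodic (c t) 1) →
        (∀ t ∈ Icc (tStart j) (tStart j + tHalf j), ∀ y,
          derivWithin (fun s => c s y) (Icc (tStart j) (tStart j + tHalf j)) t = ν * deriv (deriv (c t)) y) →
        c (tStart j) = g (2 * j) →
        ContDiffOn ℝ ∞ (Function.uncurry F) (Icc (tStart j) (tStart j + tHalf j) ×ˢ univ) →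
        (∀ t ∈ Icc (tStart j) (tStart j + tHalf j), Function.Periodic (F t) 1) → F (tStart j) = (fun _ => 0) →
        (∀ t ∈ Icc (tStart j) (tStart j + tHalf j), ∀ y,
          derivWithin (fun s => F s y) (Icc (tStart j) (tStart j + tHalf j)) t =
            ν * deriv (deriv (F t)) y + ν * (P.rateH j t * deriv (deriv (P.U j)) y)) →
        c (tStart j + tHalf j) = F (tStart j + tHalf j))
    (hrealV : ∀ j, 2 * j + 1 < K → ∀ c F : ℝ → ℝ → ℝ,
        ContDiffOn ℝ ∞ (Function.uncurry c) (Icc (tStart j + tHalf j) (tStart (j + 1)) ×ˢ univ) →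
        (∀ t ∈ Icc (tStart j + tHalf j) (tStart (j + 1)), Function.Periodic (c t) 1) →
        (∀ t ∈ Icc (tStart j + tHalf j) (tStart (j + 1)), ∀ y,
          derivWithin (fun s => c s y) (Icc (tStart j + tHalf j) (tStart (j + 1))) t = ν * deriv (deriv (c t)) y) →
        c (tStart j + tHalf j) = g (2 * j + 1) →
        ContDiffOn ℝ ∞ (Function.uncurry F) (Icc (tStart j + tHalf j) (tStart (j + 1)) ×ˢ univ) →
        (∀ t ∈ Icc (tStart j + tHalf j) (tStart (j + 1)), Function.Periodic (F t) 1) →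
        F (tStart j + tHalf j) = (fun _ => 0) →
        (∀ t ∈ Icc (tStart j + tHalf j) (tStart (j + 1)), ∀ y,
          derivWithin (fun s => F s y) (Icc (tStart j + tHalf j) (tStart (j + 1))) t =
            ν * deriv (deriv (F t)) y + ν * (P.rateV j t * deriv (deriv (P.U j)) y)) →
        c (tStart (j + 1)) = F (tStart (j + 1)))
    (hW : ∀ i < K, Torus.IsSmoothSpaceTimeOn (Icc (CascadeParams.tInject (i / 2) (i % 2 == 0)) T') (W i))
    (hR : ∀ i < K, Torus.IsSmoothSpaceTimeOn (Icc (CascadeParams.tInject (i / 2) (i % 2 == 0)) T') (R i))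
    (hWdiv : ∀ i < K, ∀ t ∈ Icc (CascadeParams.tInject (i / 2) (i % 2 == 0)) T', Torus.IsDivFree (W i t))
    (hWlin : ∀ i < K, ∀ t ∈ Icc (CascadeParams.tInject (i / 2) (i % 2 == 0)) T', ∀ x,
      Torus.timeDerivWithin (Icc (CascadeParams.tInject (i / 2) (i % 2 == 0)) T') (W i) t x +
        Torus.convect (P.field t) (W i t) x + Torus.convect (W i t) (P.field t) x =
          ν • Torus.laplacian (W i t) x - Torus.gradient (R i t) x)
    (hW0H : ∀ j, 2 * j < K → W (2 * j) (tStart j) =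
      fun x => g (2 * j) (Torus.repr x 1) • EuclideanSpace.single (0 : Fin 2) (1 : ℝ))
    (hW0V : ∀ j, 2 * j + 1 < K → W (2 * j + 1) (tStart j + tHalf j) =
      fun x => g (2 * j + 1) (Torus.repr x 0) • EuclideanSpace.single (1 : Fin 2) (1 : ℝ))
    {k : ℕ} (hk : k < K) {t : ℝ}
    (ht : t ∈ Icc (CascadeParams.tInject (k / 2) (k % 2 == 0)) (CascadeParams.tInject ((k + 1) / 2) ((k + 1) % 2 == 0)))
    (x : UnitAddTorus (Fin 2)) (i : Fin 2) :
    ‖Torus.partialDeriv i (L t) x‖ ≤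
      ∑ l ∈ Finset.range k, ‖Torus.fderiv (W l t) x‖ +
        24 * Real.pi * Real.sqrt (2 * Real.pi) * ν * ((P.N (k / 2) : ℕ) : ℝ) ^ 2 * P.γ / P.δ (k / 2) ^ 2 := by
  have hkT : CascadeParams.tInject ((k + 1) / 2) ((k + 1) % 2 == 0) ≤ T' := (slotStart_mono (Nat.succ_le_of_lt hk)).trans hK
  have hclaim := response_at_slotStart P hδ₀ hd hγ hN hν hK hL hq hLdiv hL0 hlin hg hrealH hrealV hW hR hWdiv hWlin
    hW0H hW0V k hk.le
  obtain ⟨hS, hQ, hSdiv, hSlin⟩ := partialSum_linearisedNS P hW hR hWdiv hWlin hk hkT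
  -- smoothness of the pieces at time `t`
  have hti : ∀ l ∈ Finset.range k, t ∈ Icc (CascadeParams.tInject (l / 2) (l % 2 == 0)) T' := fun l hl =>
    ⟨(slotStart_mono (Finset.mem_range.1 hl).le).trans ht.1, ht.2.trans hkT⟩
  have hW1 : ∀ l ∈ Finset.range k, Torus.IsContDiff 1 (W l t) := fun l hl =>
    ((hW l ((Finset.mem_range.1 hl).trans hk)).isSmooth_slice (hti l hl)).isContDiff (by simp)
  obtain ⟨j, rfl | rfl⟩ := Nat.even_or_odd' k
  · -- H half-slot of phase `j`
    rw [slotStart_even] at hclaim hS hQ hSdiv hSlin ht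
    rw [slotStart_even_succ] at hkT hS hQ hSdiv hSlin ht
    obtain ⟨F, hF, hFper, hF0, heatF, hLeq, -⟩ := slot_split_H P hδ₀ hd hγ (hN j) hν hkT hL hq hlin hS hQ hSdiv hSlin
      hLdiv hclaim
    rw [show 2 * j / 2 = j by omega, hLeq t ht]
    exact norm_partialDeriv_split_le (Finset.range (2 * j)) hW1 (hFper t ht) (contDiff_slice_of_contDiffOn_uncurry hF ht)
      (abs_deriv_slotProfile_H_le P hδ₀ hd hγ (hN j) hν hF hFper hF0 heatF ht) 1 0 i x
  · -- V half-slot of phase `j`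
    rw [slotStart_odd] at hclaim hS hQ hSdiv hSlin ht
    rw [slotStart_odd_succ] at hkT hS hQ hSdiv hSlin ht
    obtain ⟨F, hF, hFper, hF0, heatF, hLeq, -⟩ := slot_split_V P hδ₀ hd hγ (hN j) hν hkT hL hq hlin hS hQ hSdiv hSlin
      hLdiv hclaim
    rw [show (2 * j + 1) / 2 = j by omega, hLeq t ht]
    exact norm_partialDeriv_split_le (Finset.range (2 * j + 1)) hW1 (hFper t ht)
      (contDiff_slice_of_contDiffOn_uncurry hF ht)
      (abs_deriv_slotProfile_V_le P hδ₀ hd hγ (hN j) hν hF hFper hF0 heatF ht) 0 1 i x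

end Duhamel

end Summit.AnomalousDissipation.AnomalousDissipation.Theorems.SawtoothPulseCascade.ApproxResponse

end
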